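import Literature.NumberTheory.Sieve.LinearEquationsInPrimesCircleObstruction
import Literature.NumberTheory.Sieve.LinearEquationsInPrimesWTrickExpSum
import HarnessLib

/-!
# Green–Tao 2010, Thm. 7.2 at level `s = 1`: `‖Λ'_{b,W} − 1‖_{U²[N]} = o(1)` — PROVED

Topic `Literature/NumberTheory/Sieve`. This short file closes the level-`s = 1` slice
`Literature.NumberTheory.Sieve.GreenTao2010_gowersUniformityAt 1` of the named fact
`Literature.NumberTheory.Sieve.GreenTao2010_gowersUniformity` (Green–Tao, *Linear equations in
primes*, Ann. of Math. 171 (2010), Thm. 7.2: "`‖Λ'_{b,W} − 1‖_{U^{s+1}[N]} = o(1)`", uniformly in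
`b ∈ [W]` coprime to `W = ∏_{p ≤ w} p`, `w ≤ ½ log log N` slowly growing) UNCONDITIONALLY, by
combining

* `GreenTao2010_gowersUniformityAt_one_of_expSum` (`LinearEquationsInPrimesCircleObstruction.lean`):
  Thm. 7.2 at `s = 1` follows from the uniform exponential-sum estimate
  `sup_α |∑_{n ≤ N} (Λ'_{b,W}(n) − 1) e(nα)| = o(N)` — through the proved inverse theorem for the
  `U²[N]`-norm (`GI(1)`, `LinearEquationsInPrimesInverseU2.lean`), the proved relative inverse
  theorem Prop. 10.1, the dense model theorem, and the proved converse Cor. 11.6 for the circle;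
* `WTrick.wtrick_expSum_estimate` (`LinearEquationsInPrimesWTrickExpSum.lean`): that estimate, by
  the Hardy–Littlewood method (Siegel–Walfisz on the major arcs, Vinogradov on the minor arcs), as
  indicated in GT2010 §12 ("the case `s = 1` … can be obtained by the classical Hardy–Littlewood
  method").

The levels `s ≥ 2` of Thm. 7.2 require `GI(s)` (Green–Tao–Ziegler 2012) and the Möbius and
nilsequences theorem `MN(s)` (Green–Tao 2012) and remain recorded through the reductions of
`LinearEquationsInPrimesRelativeInverse.lean` (`GreenTao2010_gowersUniformity_of_conjectures`).

## References

* [GreenTao2010] B. Green, T. Tao, *Linear equations in primes*, Ann. of Math. 171 (2010),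
  1753–1850, Thm. 7.2, §§10–12 (arXiv:math/0606088).
-/

noncomputable section

open scoped FourierTransform

namespace Literature.NumberTheory.Sieve

/-- The additive character of `LinearEquationsInPrimesCircleObstruction.lean` is Mathlib's
`𝐞 = Real.fourierChar` read in `ℂ`. [folklore] -/
theorem eChar_eq_fourierChar (t : ℝ) : eChar t = (𝐞 t : ℂ) := (Real.fourierChar_apply t).symm

/-- **Green–Tao 2010, Thm. 7.2 at level `s = 1` (unconditional):** for every `ε > 0` there are
`w₀, N₀` such that `‖Λ'_{b,W} − 1‖_{U²[N]} ≤ ε` whenever `N ≥ N₀`, `w₀ ≤ w ≤ ½ log log N`,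
`W = ∏_{p ≤ w} p`, `b ∈ [W]`, `(b, W) = 1`. [cite: GreenTao2010, Thm. 7.2 (case `s = 1`), §12] -/
theorem GreenTao2010_gowersUniformityAt_one : GreenTao2010_gowersUniformityAt 1 := by
  refine GreenTao2010_gowersUniformityAt_one_of_expSum fun ε hε => ?_
  obtain ⟨w₀, N₀, h⟩ := WTrick.wtrick_expSum_estimate ε hε
  refine ⟨w₀, N₀, fun N hN w hw hwl b hb1 hbW hcop α => ?_⟩
  simpa only [eChar_eq_fourierChar] using h N hN w hw hwl b hb1 hbW hcop α

/-- What is left of Thm. 7.2 after this file: the named fact `GreenTao2010_gowersUniformity`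
follows from its slices at the levels `s ≥ 2` alone (the level `s = 1` being
`GreenTao2010_gowersUniformityAt_one`). [cite: GreenTao2010, Thm. 7.2] -/
theorem GreenTao2010_gowersUniformity_of_two_le
    (h : ∀ s : ℕ, 2 ≤ s → GreenTao2010_gowersUniformityAt s) : GreenTao2010_gowersUniformity := by
  rw [GreenTao2010_gowersUniformity_iff]
  intro s hs
  rcases eq_or_lt_of_le hs with h1 | h1
  · rw [← h1]; exact GreenTao2010_gowersUniformityAt_one
  · exact h s h1

end Literature.NumberTheory.Sieve
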